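import Summits.QuantumFields.YangMills.Theorems.CurvatureBoostCovariance.Negative.BetaZeroResample
import Summits.QuantumFields.YangMills.Theorems.LatticeGapOnTrajectory.Negative.ZeroCouplingGap

/-!
# `CurvatureBoostCovariance` — negative-side support V: at `β = 0` the translated action densities integrate like constants

Second file of the `β ≡ 0` COLLAPSE for crux `stmt-QuantumFields-9663` (work file §6).

* `plaquetteObs_configShift_torusLift`: the smeared field's plaquette observable at base point `x ∈ ℤ⁴` is the
  torus plaquette at `proj x`.
* `exists_private_index`, `integral_prod_cobs_eq_zero`: the torus-minimal plaquette has a PRIVATE link, so every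
  non-empty product of centred plaquette observables `Re tr ρ(U_p) − d₀` (`d₀ = ∫ Re tr ρ dHaar`) at pairwise
  torus-distinct base points integrates to `0` under product Haar.
* `integral_prod_actionDensity_sub`: `∫ ∏ᵢ (actionDensity at xᵢ − m) dHaar^{⊗links} = (6 d₀ − m)ⁿ` (`n < S`).
-/

noncomputable section

open MeasureTheory Filter Topology
open Literature.Probability.LatticeModels (Torus.proj box)
open Literature.MathematicalPhysics.AQFT Literature.MathematicalPhysics.QuantumLattice
open Literature.MathematicalPhysics.QuantumFieldTheory

namespace Summit.QuantumFields.YangMills.Theorems.CurvatureBoostCovariance.Negative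
/-! ## Stage 3: torus plaquettes at `ℤ⁴` base points; the private edge -/

section TorusAlgebra

variable {G : Type} [Group G] [MeasurableSpace G] {N : ℕ}

omit [MeasurableSpace G] in
/-- Plaquette holonomies of the periodic lift are the torus holonomies below
(as in the TunedSequenceExists disprover's work file). -/
theorem plaquetteHolonomyZd_torusLift' {S : ℕ} (U : GaugeConfig 4 S G) (y : Fin 4 → ℤ) (i j : Fin 4) :
    plaquetteHolonomyZd (torusLift S U) y i j = plaquetteHolonomy U (Torus.proj S y) i j := by
  simp only [plaquetteHolonomyZd, plaquetteHolonomy, torusLift, torusEdge, Function.comp_apply,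
    Literature.MathematicalPhysics.QuantumFieldTheory.Site.shift, torusProj_add_single, Int.cast_one]

/-- The torus plaquette observable of the translated periodic lift at base point `x`. -/
theorem plaquetteObs_configShift_torusLift {S : ℕ} (ρ : G →* Matrix (Fin N) (Fin N) ℂ)
    (x : Fin 4 → ℤ) (a b : Fin 4) (U : GaugeConfig 4 S G) :
    plaquetteObs ρ 0 a b (configShift (-x) (torusLift S U)) =
      (ρ (plaquetteHolonomy U (Torus.proj S x) a b)).trace.re := by
  simp only [plaquetteObs]
  have h : plaquetteHolonomyZd (configShift (-x) (torusLift S U)) 0 a b =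
      plaquetteHolonomyZd (torusLift S U) x a b := by
    simp only [plaquetteHolonomyZd, configShift_apply, sub_neg_eq_add, zero_add,
      add_comm (Pi.single _ _) x]
  rw [h, plaquetteHolonomyZd_torusLift']

/-- `proj` commutes with the unit shifts. -/
theorem proj_add_single {S : ℕ} (y : Fin 4 → ℤ) (a : Fin 4) :
    Literature.MathematicalPhysics.QuantumFieldTheory.Site.shift (Torus.proj S y) a =
      Torus.proj S (y + Pi.single a 1) := by
  rw [torusProj_add_single]
  simp [Literature.MathematicalPhysics.QuantumFieldTheory.Site.shift]

/-- The unit vector `e_a` has entries in `{0, 1}`. -/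
theorem single_zero_or_one (a l : Fin 4) :
    (Pi.single a (1 : ℤ) : Fin 4 → ℤ) l = 0 ∨ (Pi.single a (1 : ℤ) : Fin 4 → ℤ) l = 1 := by
  by_cases h : l = a
  · subst h; simp
  · simp [Pi.single_eq_of_ne h]

/-- The zero vector has entries in `{0, 1}`. -/
theorem zero_zero_or_one (l : Fin 4) : (0 : Fin 4 → ℤ) l = 0 ∨ (0 : Fin 4 → ℤ) l = 1 :=
  Or.inl rfl

/-- `e_a ≠ 0`. -/
theorem single_ne_zero' (a : Fin 4) : (Pi.single a (1 : ℤ) : Fin 4 → ℤ) ≠ 0 := by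
  intro h; have := congrFun h a; simp at this

omit [MeasurableSpace G] in
/-- If none of the four edges of the torus plaquette `(p, a', b')` is `E₀`, updating `E₀` does
not change its holonomy. -/
theorem plaquetteHolonomy_update_of_ne {S : ℕ} (U : GaugeConfig 4 S G) (E₀ : Edge 4 S) (g : G)
    (p : Literature.MathematicalPhysics.QuantumFieldTheory.Site 4 S) (a' b' : Fin 4)
    (h1 : (p, a') ≠ E₀)
    (h2 : (Literature.MathematicalPhysics.QuantumFieldTheory.Site.shift p a', b') ≠ E₀)
    (h3 : (Literature.MathematicalPhysics.QuantumFieldTheory.Site.shift p b', a') ≠ E₀)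
    (h4 : (p, b') ≠ E₀) :
    plaquetteHolonomy (Function.update U E₀ g) p a' b' = plaquetteHolonomy U p a' b' := by
  simp only [plaquetteHolonomy, Function.update_of_ne h1, Function.update_of_ne h2,
    Function.update_of_ne h3, Function.update_of_ne h4]

/-- **The private edge.** For base points `x i` (`i ∈ A`), injective mod `S` on `A`, with
`A.card < S`, there is `i₀ ∈ A` such that no base point of the family touches `x i₀` FROM
BELOW on the torus: `proj (x i₀) = proj (x i + ε)` with `ε ∈ {0,1}⁴`, `i ∈ A` forces `ε = 0` and
`i = i₀`. -/
theorem exists_private_index {S : ℕ} [NeZero S] {n : ℕ} (x : Fin n → Fin 4 → ℤ) (A : Finset (Fin n))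
    (hA : A.Nonempty) (hinj : ∀ i ∈ A, ∀ j ∈ A, Torus.proj S (x i) = Torus.proj S (x j) → i = j)
    (hcard : A.card < S) :
    ∃ i₀ ∈ A, ∀ ε : Fin 4 → ℤ, (∀ l, ε l = 0 ∨ ε l = 1) → ∀ i ∈ A,
      Torus.proj S (x i₀) = Torus.proj S (x i + ε) → ε = 0 ∧ i = i₀ := by
  classical
  have hcard' : (A.image x).card < S := (Finset.card_image_le).trans_lt hcard
  obtain ⟨y₀, hy₀, hmin⟩ := exists_torusMinimal (A.image x) (hA.image x) hcard'
  obtain ⟨i₀, hi₀, rfl⟩ := Finset.mem_image.1 hy₀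
  refine ⟨i₀, hi₀, fun ε hε i hi hproj => ?_⟩
  have hε0 : ε = 0 := hmin (x i) (Finset.mem_image_of_mem x hi) ε hε hproj
  subst hε0
  rw [add_zero] at hproj
  exact ⟨rfl, hinj i hi i₀ hi₀ hproj.symm⟩

end TorusAlgebra

/-! ## Stage 4: the centred moments vanish; the `β = 0` moment formula -/

section BetaZeroMoments

variable {G : Type} [Group G] [TopologicalSpace G] [IsTopologicalGroup G] [CompactSpace G]
  [MeasurableSpace G] [BorelSpace G] {N : ℕ}

/-- The Haar average `d₀ = ∫ Re tr ρ`. -/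
def haarTraceRe (ρ : G →* Matrix (Fin N) (Fin N) ℂ) : ℝ := ∫ g, (ρ g).trace.re ∂haarProbability G

/-- The CENTRED torus plaquette observable at the `ℤ⁴` base point `x`, plane `(a, b)`. -/
def cobs {S : ℕ} (ρ : G →* Matrix (Fin N) (Fin N) ℂ) (x : Fin 4 → ℤ) (a b : Fin 4)
    (U : GaugeConfig 4 S G) : ℝ :=
  (ρ (plaquetteHolonomy U (Torus.proj S x) a b)).trace.re - haarTraceRe ρ

/-- The centred plaquette observables are continuous. -/
theorem continuous_cobs {S : ℕ} (ρ : G →* Matrix (Fin N) (Fin N) ℂ) (hρ : Continuous ρ)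
    (x : Fin 4 → ℤ) (a b : Fin 4) : Continuous (cobs (S := S) ρ x a b) := by
  unfold cobs plaquetteHolonomy
  refine Continuous.sub ?_ continuous_const
  exact (continuous_trace_re ρ hρ).comp (by fun_prop)

/-- A uniform bound on the centred plaquette observables. -/
theorem exists_bound_cobs (ρ : G →* Matrix (Fin N) (Fin N) ℂ) (hρ : Continuous ρ) :
    ∃ C : ℝ, 0 ≤ C ∧ ∀ (S : ℕ) (x : Fin 4 → ℤ) (a b : Fin 4) (U : GaugeConfig 4 S G),
      |cobs ρ x a b U| ≤ C := by
  obtain ⟨B, hB0, hB⟩ := exists_bound_trace_re_nonneg ρ hρ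
  refine ⟨B + |haarTraceRe ρ|, by positivity, fun S x a b U => ?_⟩
  unfold cobs
  exact (abs_sub _ _).trans (add_le_add (hB _) le_rfl)

/-- **Vanishing of the centred moments** at `β = 0`: for base points injective mod `S` on a
non-empty index set `A` with `A.card < S` and planes `(a i, b i)` with `a i ≠ b i`,
`∫ ∏_{i ∈ A} cobs ρ (x i) (a i) (b i) dHaar^{⊗ edges} = 0` — the private edge of the
torus-minimal plaquette is integrated out first and its factor averages to zero by right
invariance of Haar. -/
theorem integral_prod_cobs_eq_zero [SecondCountableTopology G] {S : ℕ} [NeZero S]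
    (ρ : G →* Matrix (Fin N) (Fin N) ℂ) (hρ : Continuous ρ) {n : ℕ} (x : Fin n → Fin 4 → ℤ)
    (a b : Fin n → Fin 4) (hab : ∀ i, a i ≠ b i) (A : Finset (Fin n)) (hA : A.Nonempty)
    (hinj : ∀ i ∈ A, ∀ j ∈ A, Torus.proj S (x i) = Torus.proj S (x j) → i = j)
    (hcard : A.card < S) :
    ∫ U, ∏ i ∈ A, cobs ρ (x i) (a i) (b i) U
      ∂(Measure.pi fun _ : Edge 4 S => haarProbability G) = 0 := by
  classical
  obtain ⟨i₀, hi₀, hpriv⟩ := exists_private_index x A hA hinj hcard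
  obtain ⟨C, hC0, hC⟩ := exists_bound_cobs ρ hρ
  obtain ⟨B, hB0, hB⟩ := exists_bound_trace_re_nonneg ρ hρ
  set p₀ := Torus.proj S (x i₀) with hp₀
  set E₀ : Edge 4 S := (p₀, a i₀) with hE₀
  -- which edges can be `E₀`: only the first edge of the own plaquette
  have hedge : ∀ i ∈ A, ∀ ε : Fin 4 → ℤ, (∀ l, ε l = 0 ∨ ε l = 1) → ∀ c : Fin 4,
      ((Torus.proj S (x i + ε), c) : Edge 4 S) = E₀ → ε = 0 ∧ i = i₀ ∧ c = a i₀ := by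
    intro i hi ε hε c heq
    rw [hE₀, Prod.mk.injEq] at heq
    obtain ⟨h0, hii⟩ := hpriv ε hε i hi heq.1.symm
    exact ⟨h0, hii, heq.2⟩
  have hbase : ∀ i, Torus.proj S (x i) = Torus.proj S (x i + 0) := fun i => by rw [add_zero]
  -- holonomies of the other plaquettes do not see `E₀`
  have hother : ∀ i ∈ A, i ≠ i₀ → ∀ (U : GaugeConfig 4 S G) (g : G),
      cobs ρ (x i) (a i) (b i) (Function.update U E₀ g) = cobs ρ (x i) (a i) (b i) U := by
    intro i hi hne U g
    unfold cobs
    rw [plaquetteHolonomy_update_of_ne]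
    · rw [hbase i]; intro heq
      exact hne (hedge i hi 0 zero_zero_or_one _ heq).2.1
    · rw [proj_add_single]; intro heq
      exact single_ne_zero' _ (hedge i hi _ (single_zero_or_one _) _ heq).1
    · rw [proj_add_single]; intro heq
      exact single_ne_zero' _ (hedge i hi _ (single_zero_or_one _) _ heq).1
    · rw [hbase i]; intro heq
      exact hne (hedge i hi 0 zero_zero_or_one _ heq).2.1
  -- the own holonomy is `U E₀ * M U` with `M` blind to `E₀`
  set M : GaugeConfig 4 S G → G := fun U =>
    U (Literature.MathematicalPhysics.QuantumFieldTheory.Site.shift p₀ (a i₀), b i₀) *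
      (U (Literature.MathematicalPhysics.QuantumFieldTheory.Site.shift p₀ (b i₀), a i₀))⁻¹ *
        (U (p₀, b i₀))⁻¹ with hM
  have hhol : ∀ U : GaugeConfig 4 S G, plaquetteHolonomy U p₀ (a i₀) (b i₀) = U E₀ * M U := by
    intro U; simp only [plaquetteHolonomy, hM, hE₀, mul_assoc]
  have hne2 : (Literature.MathematicalPhysics.QuantumFieldTheory.Site.shift p₀ (a i₀), b i₀) ≠ E₀ := by
    rw [hp₀, proj_add_single]; intro heq
    exact hab i₀ (hedge i₀ hi₀ _ (single_zero_or_one _) _ heq).2.2.symm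
  have hne3 : (Literature.MathematicalPhysics.QuantumFieldTheory.Site.shift p₀ (b i₀), a i₀) ≠ E₀ := by
    rw [hp₀, proj_add_single]; intro heq
    exact single_ne_zero' _ (hedge i₀ hi₀ _ (single_zero_or_one _) _ heq).1
  have hne4 : ((p₀, b i₀) : Edge 4 S) ≠ E₀ := by
    rw [hp₀, hbase i₀]; intro heq
    exact hab i₀ (hedge i₀ hi₀ 0 zero_zero_or_one _ heq).2.2.symm
  have hM_upd : ∀ U g, M (Function.update U E₀ g) = M U := by
    intro U g
    simp only [hM, Function.update_of_ne hne2, Function.update_of_ne hne3, Function.update_of_ne hne4]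
  -- measurability
  have hcoord : ∀ e : Edge 4 S, Measurable fun U : GaugeConfig 4 S G => U e := fun e =>
    measurable_pi_apply e
  have hmeasM : Measurable M := by
    simp only [hM]
    exact ((hcoord _).mul (hcoord _).inv).mul (hcoord _).inv
  have hmeas_cobs : ∀ i, Measurable (cobs (S := S) ρ (x i) (a i) (b i)) := fun i =>
    (continuous_cobs ρ hρ (x i) (a i) (b i)).measurable
  -- split off the `i₀` factor
  set Ψ : GaugeConfig 4 S G → ℝ := fun U => ∏ i ∈ A.erase i₀, cobs ρ (x i) (a i) (b i) U with hΨ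
  have hsplit : ∀ U : GaugeConfig 4 S G, ∏ i ∈ A, cobs ρ (x i) (a i) (b i) U =
      ((fun g : G => (ρ g).trace.re) (U E₀ * M U) - ∫ g, (ρ g).trace.re ∂haarProbability G) * Ψ U := by
    intro U
    rw [← Finset.mul_prod_erase A _ hi₀]
    congr 1
    show cobs ρ (x i₀) (a i₀) (b i₀) U = _
    unfold cobs haarTraceRe
    rw [← hp₀, hhol U]
  simp_rw [hsplit]
  refine integral_centred_private_eq_zero (haarProbability G) E₀ (f := fun g : G => (ρ g).trace.re)
    ((continuous_trace_re ρ hρ).measurable) (Cf := B) hB (h := M) hM_upd hmeasM (Ψ := Ψ) ?_ ?_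
    (CΨ := C ^ (A.erase i₀).card) ?_
  · intro U g
    simp only [hΨ]
    refine Finset.prod_congr rfl fun i hi => ?_
    exact hother i (Finset.mem_of_mem_erase hi) (Finset.ne_of_mem_erase hi) U g
  · simp only [hΨ]
    exact Finset.measurable_prod _ fun i _ => hmeas_cobs i
  · intro U
    simp only [hΨ]
    rw [Finset.abs_prod]
    calc ∏ i ∈ A.erase i₀, |cobs ρ (x i) (a i) (b i) U| ≤ ∏ _i ∈ A.erase i₀, C :=
          Finset.prod_le_prod (fun i _ => abs_nonneg _) fun i _ => hC _ _ _ _ _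
      _ = C ^ (A.erase i₀).card := Finset.prod_const C

end BetaZeroMoments

/-! ## Stage 4b: the `β = 0` moment formula -/

section MomentFormula

variable {G : Type} [Group G] [TopologicalSpace G] [IsTopologicalGroup G] [CompactSpace G]
  [MeasurableSpace G] [BorelSpace G] {N : ℕ}

omit [TopologicalSpace G] [IsTopologicalGroup G] [CompactSpace G] [MeasurableSpace G] [BorelSpace G] in
/-- The action density as a sum over the six planes `a < b`. -/
theorem actionDensity_eq_sum_planes (ρ : G →* Matrix (Fin N) (Fin N) ℂ) (V : LGConfig 4 G) :
    actionDensity ρ V = ∑ q : {p : Fin 4 × Fin 4 // p.1 < p.2}, plaquetteObs ρ 0 q.1.1 q.1.2 V := by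
  unfold actionDensity
  rw [← Finset.sum_product', Finset.univ_product_univ, ← Finset.sum_filter]
  exact Finset.sum_subtype _ (fun x => by simp) (fun x : Fin 4 × Fin 4 => plaquetteObs ρ 0 x.1 x.2 V)

/-- There are six coordinate planes. -/
theorem card_planes : Fintype.card {p : Fin 4 × Fin 4 // p.1 < p.2} = 6 := by decide

/-- **The `β = 0` moment formula.** For `n < S` base points that are pairwise distinct on the
torus of side `S`, under product Haar,
`∫ ∏ᵢ (actionDensity at xᵢ − m) = (6 d₀ − m)ⁿ`, `d₀ = ∫ Re tr ρ dHaar`: the product of the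
translated action densities integrates like a product of CONSTANTS. -/
theorem integral_prod_actionDensity_sub [SecondCountableTopology G] {S : ℕ} [NeZero S]
    (ρ : G →* Matrix (Fin N) (Fin N) ℂ) (hρ : Continuous ρ) {n : ℕ} (x : Fin n → Fin 4 → ℤ)
    (hinj : Function.Injective fun i => Torus.proj S (x i)) (hn : n < S) (m : ℝ) :
    ∫ U, ∏ i, (actionDensity ρ (configShift (-(x i)) (torusLift S U)) - m)
        ∂(Measure.pi fun _ : Edge 4 S => haarProbability G) = (6 * haarTraceRe ρ - m) ^ n := by
  classical
  set K : ℝ := 6 * haarTraceRe ρ - m with hK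
  set μ : Measure (GaugeConfig 4 S G) := Measure.pi fun _ : Edge 4 S => haarProbability G with hμ
  -- the Option encoding of "constant or a centred plane factor"
  let term : Fin n → Option {p : Fin 4 × Fin 4 // p.1 < p.2} → GaugeConfig 4 S G → ℝ :=
    fun i o U => o.elim K fun q => cobs ρ (x i) q.1.1 q.1.2 U
  have hfac : ∀ (i : Fin n) (U : GaugeConfig 4 S G),
      actionDensity ρ (configShift (-(x i)) (torusLift S U)) - m = ∑ o, term i o U := by
    intro i U
    rw [Fintype.sum_option, actionDensity_eq_sum_planes]
    simp only [term, Option.elim, plaquetteObs_configShift_torusLift, cobs]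
    rw [Finset.sum_sub_distrib, Finset.sum_const, Finset.card_univ, card_planes, hK]
    ring
  simp_rw [hfac, Fintype.prod_sum]
  -- bounds and measurability of the terms
  obtain ⟨C, hC0, hC⟩ := exists_bound_cobs ρ hρ
  have hterm_bd : ∀ i o (U : GaugeConfig 4 S G), |term i o U| ≤ max |K| C := by
    intro i o U; cases o with
    | none => exact le_max_left _ _
    | some q => exact (hC S (x i) q.1.1 q.1.2 U).trans (le_max_right _ _)
  have hterm_meas : ∀ i o, Measurable (term i o) := by
    intro i o; cases o with
    | none => exact measurable_const
    | some q => exact (continuous_cobs ρ hρ (x i) q.1.1 q.1.2).measurable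
  have hint : ∀ χ : Fin n → Option {p : Fin 4 × Fin 4 // p.1 < p.2},
      Integrable (fun U => ∏ i, term i (χ i) U) μ := by
    intro χ
    refine Integrable.of_bound (Finset.measurable_prod _ fun i _ => hterm_meas i (χ i)).aestronglyMeasurable
      ((max |K| C) ^ n) (ae_of_all _ fun U => ?_)
    rw [Real.norm_eq_abs, Finset.abs_prod]
    calc ∏ i, |term i (χ i) U| ≤ ∏ _i : Fin n, max |K| C :=
          Finset.prod_le_prod (fun i _ => abs_nonneg _) fun i _ => hterm_bd i (χ i) U
      _ = (max |K| C) ^ n := by rw [Finset.prod_const, Finset.card_univ, Fintype.card_fin]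
  rw [integral_finsetSum _ fun χ _ => hint χ]
  -- only the all-constant term survives
  rw [Finset.sum_eq_single (fun _ => none)]
  · simp only [term, Option.elim, Finset.prod_const, Finset.card_univ, Fintype.card_fin,
      integral_const, hμ, probReal_univ, smul_eq_mul, one_mul]
  · intro χ _ hχ
    -- a genuine centred factor is present
    have hex : ∃ i, χ i ≠ none := by
      by_contra hall
      push Not at hall
      exact hχ (funext hall)
    set A : Finset (Fin n) := Finset.univ.filter fun i => χ i ≠ none with hA
    have hAne : A.Nonempty := by
      obtain ⟨i, hi⟩ := hex
      exact ⟨i, Finset.mem_filter.2 ⟨Finset.mem_univ _, hi⟩⟩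
    let a' : Fin n → Fin 4 := fun i => (χ i).elim 0 fun q => q.1.1
    let b' : Fin n → Fin 4 := fun i => (χ i).elim 1 fun q => q.1.2
    have hab : ∀ i, a' i ≠ b' i := by
      intro i; simp only [a', b']
      cases h : χ i with
      | none => simp
      | some q => simpa using q.2.ne
    have hsplit : ∀ U : GaugeConfig 4 S G, ∏ i, term i (χ i) U =
        K ^ (Finset.univ.filter fun i => χ i = none).card * ∏ i ∈ A, cobs ρ (x i) (a' i) (b' i) U := by
      intro U
      rw [← Finset.prod_filter_mul_prod_filter_not Finset.univ (fun i => χ i = none)]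
      congr 1
      · rw [← Finset.prod_const K]
        refine Finset.prod_congr rfl fun i hi => ?_
        rw [(Finset.mem_filter.1 hi).2]
        rfl
      · refine Finset.prod_congr rfl fun i hi => ?_
        have hne := (Finset.mem_filter.1 hi).2
        obtain ⟨q, hq⟩ := Option.ne_none_iff_exists'.1 hne
        simp only [term, a', b', hq, Option.elim]
    simp_rw [hsplit]
    rw [integral_const_mul, integral_prod_cobs_eq_zero ρ hρ x a' b' hab A hAne
      (fun i _ j _ h => hinj h) ((Finset.card_filter_le _ _).trans_lt (by simpa using hn)), mul_zero]
  · intro h; exact absurd (Finset.mem_univ _) h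

end MomentFormula


end Summit.QuantumFields.YangMills.Theorems.CurvatureBoostCovariance.Negative

end
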